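import Literature.AnabelianGeometry.EtaleTheta.Discharge.Sec5StrvTransportOfBiKummerData
import Literature.AlgebraicGeometry.Frobenioids.ModelFrobenioidBaseSectionThrough
import Literature.AlgebraicGeometry.Frobenioids.BaseSectionsOfObjectsProofs

/-!
# [FrdI] Prop. 5.6 at a model Frobenioid: every Frobenius-trivial object carries a section pair `(σ, φ)` (p. 105)

Mochizuki, *The geometry of Frobenioids I*, Kyushu J. Math. **62** (2008), Prop. 5.6 p.105 [cite: MochizukiFrdI2008, Prop. 5.6 p.105]:
"Let `(P, F)` be a base-Frobenius pair of `C`; `A ∈ Ob(P)` a Frobenius-trivial object … Then the pair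
`(σ : Aut_D(A_D) ↪ Aut_C(A), φ : N_{≥1} → End_C(A))` … determined by 'restricting' `P`, `F` to `A` … We shall refer to such a pair
as a base-Frobenius pair of `A`"; [EtTh] §5 p.330–331 (PDF pp.104–105): `s^trv_N` "aris[es] from a base-Frobenius pair of `A_N`".

PROOF-ONLY (no definitions, no new named facts).  abc-iut cell, layer L2, row #2-R18 / RULINGS #6 (R52) (prover abc-iut-w5-d245):
NON-VACUITY of the one datum-level input left in the transport chain `Sec5StrvTransportOfBiKummerData` (p427158) /
`Sec5TransportsSameUnitOfBiKummerData` (p427494) / `Sec5PsiTransportDataOfBiKummerData` — «`s^trv_N = σ` extends to a section pair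
`(σ, φ)` at `A_N`».  For the MODEL Frobenioid ([FrdI] Thm. 5.2: `Φ` divisorial, `B` group-like) every Frobenius-trivial object `A`
ADMITS such a pair: abc-iut-L1's `ModelFrobenioid.exists_isBaseFrobeniusPair_obj` (a base-Frobenius pair `(P, F)` through `A`),
`PreFrobenioid.prop56_exists` (its restriction to `A`), and `IsRestrictedPair.sectionPair` (p427158).  So a §5 datum assembled with
`σ :=` such a restricted section (the print-faithful choice of `s^trv_N`) meets the input; nothing here says the assembled
`ofBiKummerData` of record was built that way (abc-iut-L2-t4's W3-L2-01 design; `σ` is a parameter there).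
No side is taken on [IUTchIII] Cor. 3.12.
-/

namespace Literature.AlgebraicGeometry.Frobenioids

open CategoryTheory Opposite

namespace ModelFrobenioid

universe w v u

variable {D : Type u} [Category.{v} D] {Φ B : Dᵒᵖ ⥤ CommMonCat.{w}} {DivB : B ⟶ monoidGp Φ}

/-- **Section pairs exist at every Frobenius-trivial object of a model Frobenioid** ([FrdI] Prop. 5.6 "a base-Frobenius pair
of `A`"; Thm. 5.2 (ii)): for `Φ` divisorial and `B` group-like, a Frobenius-trivial `A` admits `σ : Aut_D(A_D) → Aut_C(A)` and
`φ : ℕ_{≥1} → End_C(A)` with `σ` a section of `Base`, `φ(n)` base-identity of Frobenius type of degree `n`, and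
`σ(g) ∘ φ(n) = φ(n) ∘ σ(g)` — the hypothesis shape `(hσ, hφ, hc)` of `PreFrobenioid.sectionPairs_conjugate` /
`ThetaFrobenioid.exists_unit_strvTransport_ofBiKummerData`.  [cite: MochizukiFrdI2008, Prop. 5.6 p.105] -/
theorem exists_sectionPair_of_isFrobeniusTrivial (hΦd : Objectwise (fun M _ => IsDivisorial M) Φ)
    (hBg : Objectwise (fun M _ => IsGroupLike M) B) (hF : PreFrobenioid.IsFrobenioid (toElem Φ B DivB))
    (A : ModelFrobenioid Φ B DivB) (hA : PreFrobenioid.IsFrobeniusTrivial (toElem Φ B DivB) A) :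
    ∃ (σ : Aut (PreFrobenioid.baseObj (toElem Φ B DivB) A) →* Aut A) (φ : ℕ+ →* End A),
      (∀ g, (PreFrobenioid.baseFunctor (toElem Φ B DivB)).mapIso (σ g) = g) ∧
      (∀ n : ℕ+, PreFrobenioid.degFr (toElem Φ B DivB) (End.asHom (φ n)) = n ∧
        PreFrobenioid.IsBaseIdentity (toElem Φ B DivB) (End.asHom (φ n)) ∧
        PreFrobenioid.IsFrobeniusType (toElem Φ B DivB) (End.asHom (φ n))) ∧
      ∀ (n : ℕ+) (g : Aut (PreFrobenioid.baseObj (toElem Φ B DivB) A)),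
        (σ g).hom ≫ End.asHom (φ n) = End.asHom (φ n) ≫ (σ g).hom := by
  obtain ⟨P, Fr, hPF, hAP⟩ :=
    exists_isBaseFrobeniusPair_obj (DivB := DivB) hΦd hBg A (exists_cls_eq_divB_of_isFrobeniusTrivial A hA)
  obtain ⟨σ, φ, hr⟩ := PreFrobenioid.prop56_exists (toElem Φ B DivB) hF P Fr hPF A hAP
  exact ⟨σ, φ, PreFrobenioid.IsRestrictedPair.sectionPair (toElem Φ B DivB) hPF hr⟩

/-- The same under abc-iut-L1's standing package `ModelFrobenioid.Hypotheses` ([FrdI] Thm. 5.2 (ii): then `C` is a Frobenioid).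
[cite: MochizukiFrdI2008, Thm. 5.2 (ii) p.101] -/
theorem exists_sectionPair_of_hypotheses (h : Hypotheses Φ B) (A : ModelFrobenioid Φ B DivB)
    (hA : PreFrobenioid.IsFrobeniusTrivial (toElem Φ B DivB) A) :
    ∃ (σ : Aut (PreFrobenioid.baseObj (toElem Φ B DivB) A) →* Aut A) (φ : ℕ+ →* End A),
      (∀ g, (PreFrobenioid.baseFunctor (toElem Φ B DivB)).mapIso (σ g) = g) ∧
      (∀ n : ℕ+, PreFrobenioid.degFr (toElem Φ B DivB) (End.asHom (φ n)) = n ∧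
        PreFrobenioid.IsBaseIdentity (toElem Φ B DivB) (End.asHom (φ n)) ∧
        PreFrobenioid.IsFrobeniusType (toElem Φ B DivB) (End.asHom (φ n))) ∧
      ∀ (n : ℕ+) (g : Aut (PreFrobenioid.baseObj (toElem Φ B DivB) A)),
        (σ g).hom ≫ End.asHom (φ n) = End.asHom (φ n) ≫ (σ g).hom :=
  exists_sectionPair_of_isFrobeniusTrivial (DivB := DivB) h.isDivisorial h.isGroupLike_rat
    (isFrobenioid (DivB := DivB) h.isMonoidOn h.isDivisorial h.isMonoidOn_rat h.isGroupLike_rat h.isGraphConnected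
      h.isTotallyEpimorphic) A hA

end ModelFrobenioid

end Literature.AlgebraicGeometry.Frobenioids
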